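import Literature.Probability.Percolation.QuadCrossingSpace
import Literature.Probability.Percolation.QuadCrossingRotationInvariance
import Literature.Probability.RandomPlanarGeometry.ConformalMap
import Mathlib.Topology.MetricSpace.Thickening
import Mathlib.MeasureTheory.Measure.ProbabilityMeasure
import HarnessLib

/-!
# Restriction, push-forward by domain homeomorphisms, and scaling limits in the Schramm–Smirnov space

Topic `Literature/Probability/Percolation`; definition request `defn-QuadCrossingPushforward`
(route `Summits/CriticalPhenomena/CardyFormulaZ2/Theses/CardyBlackNoise`, item
`stmt-CriticalPhenomena-8849` = crux OverlayUpgrade and its foreseen children MeasureClassUpgrade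
"`(φ_ε)_* Ξ_𝔻 = Ξ_(φ_ε 𝔻)`" and SymmetryToInvariance "`g_* Ξ_U = Ξ_(gU)` for all conformal `g`").
Companion to the tree file `QuadCrossingSpace.lean` (the space `ℋ_D = QuadConfig D` of closed lower
sets of quads with the Schramm–Smirnov topology `𝒯_D`, its Borel `σ`-field, the crossing events
`⊞_Q = QuadConfig.crossedEvent Q`), which this file extends by the three pieces the route asks for.

**Sources (held, read).**

* [SchrammSmirnov2011] O. Schramm, S. Smirnov, *On the scaling limits of planar percolation*,
  Ann. Probab. 39 (2011) 1768–1814, arXiv:1101.5820, §1.3–1.4.  Theorem 1.4 (4): "Let `D' ⊂ D` be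
  a subdomain, and for `S ∈ ℋ_D` let `S' := S ∩ 𝒬_{D'}`.  Then `S ↦ S'` is a continuous map from
  `ℋ_D` to `ℋ_{D'}`."  After Cor. 1.6 (p. 11 of the arXiv version): "By Theorem 1.4, the Borel
  `σ`-field of `ℋ_D` is `σ(⊞_Q, Q ∈ 𝒬_D)`.  Let `𝓕_D := σ(⊞_Q : Q ∈ 𝒬_D)` also denote the
  corresponding subfield of the Borel `σ`-field of `ℋ_ℂ`."  Cor. 1.5–1.6 and Remark 8: the Borel
  probability measures on `ℋ_D` form a compact metrizable space, the discrete laws are precompact,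
  and "it is enough to work with the notion of convergence along sequences".
* [GarbanPeteSchramm2013Pivotal] C. Garban, G. Pete, O. Schramm, *Pivotal, cluster and interface
  measures for critical planar percolation*, J. Amer. Math. Soc. 26 (2013), arXiv:1008.1378, §2.2
  (the quad-crossing space, restated) and §2.3: for a conformal map `f : Ω → Ω̃`, "if `ω` is a
  scaling limit for `(ℋ_Ω, 𝒯_Ω)`, then `ω̃ := f(ω)` (defined by `⊞_{f(Q)}(ω̃) := ⊞_Q(ω)` …) has the
  law of a continuum percolation for `(ℋ_Ω̃, 𝒯_Ω̃)`"; §1.3, Thm. 2: "`ω̃ = f(ω)` the image of the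
  continuum percolation `ω ∈ ℋ_Ω`".

**Contents** (namespace `Literature.Probability.Percolation.QuadCrossing`).

* (a) *Subdomains.*  `Quad.incl : Quad U → Quad D` for `U ⊆ D` (an isometric embedding, open when
  `U` is open: `Quad.isOpenEmbedding_incl`), the **restriction map** `QuadConfig.restrict`,
  `S ↦ S ∩ 𝒬_U` (Thm. 1.4 (4); continuity PROVED: `QuadConfig.continuous_restrict`), and the
  **sub-`σ`-field** `QuadConfig.crossingSubfield U = 𝓕_U = σ(⊞_Q : [Q] ⊆ U)` of the Borel
  `σ`-field of `ℋ_D` (`crossingSubfield_le_borel`, `crossingSubfield_mono`,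
  `comap_restrict_crossingSubfield`; with Thm. 1.4 (2), `crossingSubfield_univ_eq_borel`).
* (b) *Domain homeomorphisms and push-forwards.*  `DomainHomeomorph D D'`: a bijection `D → D'`
  given by plane maps continuous on `D`, resp. `D'` (bundled like the tree's `ConformalEquiv`:
  a `PartialEquiv ℂ ℂ` with `source = D`, `target = D'`), with the constructors
  `ofConformalEquiv` (a conformal = injective holomorphic map of `D` onto `D'`), `ofHomeomorph`
  (a plane homeomorphism with `h '' D = D'`), `ofInjOnCompact` (a map continuous and injective
  on a compact `K ⊇ D`, e.g. `φ_ε(z) = z + εz³` on the closed disc), `refl`, `symm`, `trans`,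
  `restr`.  The induced maps: `Quad.mapDomain h : Q ↦ h ∘ Q` and the homeomorphism
  `Quad.domainCongr h : 𝒬_D ≃ₜ 𝒬_{D'}` (crossings, `≤` and `<` are transported:
  `Quad.IsCrossing.mapDomain`, `Quad.Dominated.mapDomain`, `Quad.StrictlyDominated.mapDomain`);
  **`h_* = QuadConfig.mapDomain h : ℋ_D → ℋ_{D'}`**, `S ↦ {h ∘ Q : Q ∈ S}` (closed lower sets go
  to closed lower sets), characterised by GPS's identity `⊞_{h∘Q}(h_* S) ↔ ⊞_Q(S)`
  (`QuadConfig.mapDomain_mem_crossedEvent_iff`), a homeomorphism `QuadConfig.domainCongr h`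
  (hence Borel bi-measurable), functorial (`mapDomain_trans`, `mapDomain_refl`,
  `mapDomain_symm_mapDomain`), with `h_*(𝓕_U) = 𝓕_{h(U)}` (`map_mapDomain_crossingSubfield`); the
  **push-forward of laws** `mapLaw h μ = (h_*)_# μ` on finite Borel measures and `mapProbLaw h`
  on Borel probability measures (functorial, continuous for weak convergence).
* (c) *Encodings and subsequential scaling limits.*  `configOfSet D A ∈ ℋ_D`, the configuration
  of quads of `D` crossed inside a plane set `A` (the tree's `configOf z δ D ω` is the case
  `A = openEdgeRealization z δ ω`, by `rfl`), and its transport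
  `h_*(configOfSet D A) = configOfSet D' (h '' (A ∩ D))` (`QuadConfig.mapDomain_configOfSet`,
  PROVED); for bond percolation on `δℤ²` drawn with `meshPoint δ` (`openEdgeUnion δ ω`, the
  convention of `quadCrossing` in `QuadCrossingRotationInvariance.lean` used by the route):
  `meshConfig D δ ω`, its law `meshLaw D δ` under `P_{1/2}`, the **bent lattice** `h(δℤ² ∩ D)`
  encoded in `ℋ_{D'}`: `imageMeshConfig h δ ω = configOfSet D' (h '' (openEdgeUnion δ ω ∩ D))`,
  its law `imageMeshLaw h δ`, the identity `imageMeshLaw h δ = mapLaw h (meshLaw D δ)` (PROVED),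
  and the predicates `IsSubseqScalingLimit D δ μ` ("`μ` is the weak limit of the laws at meshes
  `δ k → 0⁺`", Cor. 1.5–1.6, Remark 8) and `IsSubseqImageScalingLimit h δ μ'` (the same for the
  bent lattice), with `IsSubseqScalingLimit.image` and `isSubseqImageScalingLimit_iff`
  (the bent limit along `δ` is exactly `h_*` of the straight limit along `δ`).

Laws are `FiniteMeasure`s, as in `QuadCrossingSpace.lean` (`Measure.map` of a non-measurable map
is `0`; measurability of the encodings — each `{ω : Q ∈ S_ω}` depends on the finitely many edges
drawn through `[Q]` — is not claimed here, exactly as for the tree's `crossingLaw`).  The source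
allows `D ⊂ ℂ̂`; as in the companion file everything is over `D ⊆ ℂ`.  No named fact is
introduced.

## Mathlib / tree search

Mathlib: `PartialEquiv`, `Homeomorph`, `ContinuousMap.isInducing_postcomp` (continuity of
`Q ↦ h ∘ Q` for `h` merely continuous on `D`, through `C([0,1]², D)`),
`IsCompact.exists_thickening_subset_open` (quads near a quad of an open `U` stay in `U`),
`IsOpenMap.preimage_interior_eq_interior_preimage`, `MeasurableSpace.map/comap/generateFrom`,
`FiniteMeasure.map`, `ProbabilityMeasure.map`, `FiniteMeasure.continuous_map`.  No Mathlib notion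
of quads / hereditary sets (`lean search 'QuadConfig|IsLowerQuadSet|crossedEvent'`: only the two
tree files `QuadCrossingSpace.lean`, `QuadCrossingLowerSets.lean`).  Tree: `Quad`, `QuadConfig`,
`crossedEvent`, `configOf`, `crossingLaw`, `Quad.mapHomeomorph`/`QuadConfig.mapHomeomorph` (plane
homeomorphisms acting on `ℋ_ℂ`; `QuadConfig.mapDomain_ofHomeomorph` identifies them with the
case `D = D' = ℂ` of `mapDomain`), `ConformalEquiv`, `openEdgeUnion`, `bondPercolation`, `half`.

## References

* [SchrammSmirnov2011] O. Schramm, S. Smirnov, Ann. Probab. 39 (2011) 1768–1814, arXiv:1101.5820,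
  §1.3, Thm. 1.4 (2), (4), Cor. 1.5–1.6, Remark 8, p. 11 (`𝓕_D`).
* [GarbanPeteSchramm2013Pivotal] C. Garban, G. Pete, O. Schramm, J. Amer. Math. Soc. 26 (2013)
  939–1024, arXiv:1008.1378, §1.3 Thm. 2, §2.2–2.3.
-/

noncomputable section

open scoped Topology unitInterval
open Set Filter MeasureTheory Metric Topology

namespace Literature.Probability.Percolation

namespace QuadCrossing

/-! ### (a) Subdomains: inclusion of quads, restriction of configurations, the sub-`σ`-fields `𝓕_U` -/

namespace Quad

variable {U D : Set ℂ}

/-- `Q z ∈ D` for a quad `Q` of `D`. [folklore] -/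
theorem apply_mem (Q : Quad D) (z : I × I) : Q z ∈ D := Q.range_subset ⟨z, rfl⟩

/-- A quad of `U ⊆ D` is a quad of `D` (`𝒬_U ⊆ 𝒬_D`). [cite: SchrammSmirnov2011, Thm. 1.4 (4)] -/
def incl (hUD : U ⊆ D) (Q : Quad U) : Quad D :=
  ⟨Q.toFun, Q.continuous_toFun, Q.injective_toFun, Q.range_subset.trans hUD⟩

/-- `incl_apply`: structural lemma for the definitions above. [folklore] -/
@[simp] theorem incl_apply (hUD : U ⊆ D) (Q : Quad U) (z : I × I) : Q.incl hUD z = Q z := rfl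

/-- `toContinuousMap_incl`: structural lemma for the definitions above. [folklore] -/
theorem toContinuousMap_incl (hUD : U ⊆ D) (Q : Quad U) :
    (Q.incl hUD).toContinuousMap = Q.toContinuousMap := rfl

/-- `carrier_incl`: structural lemma for the definitions above. [folklore] -/
@[simp] theorem carrier_incl (hUD : U ⊆ D) (Q : Quad U) : (Q.incl hUD).carrier = Q.carrier := rfl

/-- `side_incl`: structural lemma for the definitions above. [folklore] -/
@[simp] theorem side_incl (hUD : U ⊆ D) (Q : Quad U) (k : Fin 4) :
    (Q.incl hUD).side k = Q.side k := by
  match k with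
  | 0 => rfl
  | 1 => rfl
  | 2 => rfl
  | 3 => rfl

/-- Crossings of a quad do not depend on the ambient domain. [folklore] -/
theorem isCrossing_incl_iff (hUD : U ⊆ D) {Q : Quad U} {K : Set ℂ} :
    (Q.incl hUD).IsCrossing K ↔ Q.IsCrossing K := Iff.rfl

/-- The order `≤` of quads does not depend on the ambient domain. [folklore] -/
theorem dominated_incl_iff (hUD : U ⊆ D) {Q₁ Q₂ : Quad U} :
    Dominated (Q₁.incl hUD) (Q₂.incl hUD) ↔ Dominated Q₁ Q₂ := Iff.rfl

/-- `𝒬_U → 𝒬_D` is an isometric embedding (both carry the uniform metric). [folklore] -/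
theorem isometry_incl (hUD : U ⊆ D) : Isometry (incl hUD : Quad U → Quad D) := fun _ _ => rfl

/-- `continuous_incl`: structural lemma for the definitions above. [folklore] -/
theorem continuous_incl (hUD : U ⊆ D) : Continuous (incl hUD : Quad U → Quad D) :=
  (isometry_incl hUD).continuous

/-- `incl_injective`: structural lemma for the definitions above. [folklore] -/
theorem incl_injective (hUD : U ⊆ D) : Function.Injective (incl hUD : Quad U → Quad D) :=
  (isometry_incl hUD).injective

/-- The quads of `D` coming from `U` are those with `[Q] ⊆ U`. [folklore] -/
theorem range_incl (hUD : U ⊆ D) : range (incl hUD) = {Q : Quad D | Q.carrier ⊆ U} := by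
  ext Q
  constructor
  · rintro ⟨Q, rfl⟩
    exact Q.carrier_subset
  · intro hQ
    exact ⟨⟨Q.toFun, Q.continuous_toFun, Q.injective_toFun, hQ⟩, rfl⟩

/-- For `U` open, `{Q ∈ 𝒬_D : [Q] ⊆ U}` is open in the uniform metric: a compact `[Q] ⊆ U` has a
`δ`-thickening inside `U`, and quads `δ`-close to `Q` lie in that thickening. [folklore] -/
theorem isOpen_setOf_carrier_subset (hU : IsOpen U) : IsOpen {Q : Quad D | Q.carrier ⊆ U} := by
  rw [Metric.isOpen_iff]
  intro Q hQ
  obtain ⟨ε, hε, hthick⟩ := Q.isCompact_carrier.exists_thickening_subset_open hU hQ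
  refine ⟨ε, hε, fun Q' hQ' => ?_⟩
  show Q'.carrier ⊆ U
  rintro _ ⟨z, rfl⟩
  refine hthick (Metric.mem_thickening_iff.2 ⟨Q z, ⟨z, rfl⟩, ?_⟩)
  exact (dist_apply_le Q' Q z).trans_lt hQ'

/-- `isOpen_range_incl`: structural lemma for the definitions above. [folklore] -/
theorem isOpen_range_incl (hU : IsOpen U) (hUD : U ⊆ D) : IsOpen (range (incl hUD)) := by
  rw [range_incl]
  exact isOpen_setOf_carrier_subset hU

/-- For `U` open, `𝒬_U → 𝒬_D` is an open embedding. [folklore] -/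
theorem isOpenEmbedding_incl (hU : IsOpen U) (hUD : U ⊆ D) : IsOpenEmbedding (incl hUD) :=
  ⟨(isometry_incl hUD).isEmbedding, isOpen_range_incl hU hUD⟩

/-- For `U` open, the strict order `<` (the interior of `≤`) does not depend on the ambient
domain either: `𝒬_U × 𝒬_U → 𝒬_D × 𝒬_D` is an open embedding pulling `≤` back to `≤`. [folklore] -/
theorem strictlyDominated_incl_iff (hU : IsOpen U) (hUD : U ⊆ D) {Q₁ Q₂ : Quad U} :
    StrictlyDominated (Q₁.incl hUD) (Q₂.incl hUD) ↔ StrictlyDominated Q₁ Q₂ := by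
  have hf : IsOpenEmbedding (Prod.map (incl hUD) (incl hUD)) :=
    (isOpenEmbedding_incl hU hUD).prodMap (isOpenEmbedding_incl hU hUD)
  have hR : {p : Quad U × Quad U | Dominated p.1 p.2} =
      Prod.map (incl hUD) (incl hUD) ⁻¹' {p : Quad D × Quad D | Dominated p.1 p.2} := rfl
  change (Q₁.incl hUD, Q₂.incl hUD) ∈ interior {p : Quad D × Quad D | Dominated p.1 p.2} ↔
    (Q₁, Q₂) ∈ interior {p : Quad U × Quad U | Dominated p.1 p.2}
  rw [hR, ← hf.isOpenMap.preimage_interior_eq_interior_preimage hf.continuous]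
  rfl

end Quad

namespace QuadConfig

variable {U D : Set ℂ}

/-- **The restriction map `ℋ_D → ℋ_U`, `S ↦ S ∩ 𝒬_U`** (Schramm–Smirnov, Thm. 1.4 (4): "Let
`D' ⊂ D` be a subdomain, and for `S ∈ ℋ_D` let `S' := S ∩ 𝒬_{D'}`"), for `U ⊆ D` open: the quads
of `U` crossed in `S` (a closed lower set of `𝒬_U`: closed as a preimage under the embedding
`𝒬_U → 𝒬_D`, lower because `<` is the same in `𝒬_U` and `𝒬_D`, `Quad.strictlyDominated_incl_iff`,
which uses that `U` is open). [cite: SchrammSmirnov2011, Thm. 1.4 (4)] -/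
def restrict (hU : IsOpen U) (hUD : U ⊆ D) (S : QuadConfig D) : QuadConfig U :=
  ⟨Quad.incl hUD ⁻¹' (S : Set (Quad D)), S.isClosed.preimage (Quad.continuous_incl hUD),
    fun _ hQ _ hlt => S.isLowerQuadSet hQ ((Quad.strictlyDominated_incl_iff hU hUD).2 hlt)⟩

/-- `mem_restrict`: structural lemma for the definitions above. [folklore] -/
@[simp] theorem mem_restrict (hU : IsOpen U) (hUD : U ⊆ D) {S : QuadConfig D} {Q : Quad U} :
    Q ∈ S.restrict hU hUD ↔ Q.incl hUD ∈ S := Iff.rfl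

/-- `coe_restrict`: structural lemma for the definitions above. [folklore] -/
theorem coe_restrict (hU : IsOpen U) (hUD : U ⊆ D) (S : QuadConfig D) :
    (S.restrict hU hUD : Set (Quad U)) = Quad.incl hUD ⁻¹' (S : Set (Quad D)) := rfl

/-- Restriction is monotone (for inclusion of configurations). [folklore] -/
theorem restrict_mono (hU : IsOpen U) (hUD : U ⊆ D) : Monotone (restrict hU hUD) :=
  fun _ _ hST _ hQ => hST hQ

/-- `restrict_preimage_notCrossed`: structural lemma for the definitions above. [folklore] -/
theorem restrict_preimage_notCrossed (hU : IsOpen U) (hUD : U ⊆ D) (Q : Quad U) :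
    restrict hU hUD ⁻¹' notCrossed Q = notCrossed (Q.incl hUD) := rfl

/-- The restriction pulls the crossing event of a quad of `U` back to its crossing event in
`ℋ_D`. [cite: SchrammSmirnov2011, Thm. 1.4 (4)] -/
theorem restrict_preimage_crossedEvent (hU : IsOpen U) (hUD : U ⊆ D) (Q : Quad U) :
    restrict hU hUD ⁻¹' crossedEvent Q = crossedEvent (Q.incl hUD) := rfl

/-- `restrict_preimage_someCrossed`: structural lemma for the definitions above. [folklore] -/
theorem restrict_preimage_someCrossed (hU : IsOpen U) (hUD : U ⊆ D) (V : Set (Quad U)) :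
    restrict hU hUD ⁻¹' someCrossed V = someCrossed (Quad.incl hUD '' V) := by
  ext S
  simp only [mem_preimage, someCrossed, mem_setOf_eq]
  constructor
  · rintro ⟨Q, hQS, hQV⟩
    exact ⟨Q.incl hUD, hQS, Q, hQV, rfl⟩
  · rintro ⟨_, hQS, Q, hQV, rfl⟩
    exact ⟨Q, hQS, hQV⟩

/-- **Theorem 1.4 (4): the restriction `ℋ_D → ℋ_U` is continuous** (`U ⊆ D` open).  The
preimages of the subbasic open sets are subbasic: `V^Q ↦ V^{Q}` and `V_W ↦ V_{W}` (`W ⊆ 𝒬_U`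
open stays open in `𝒬_D`, `Quad.isOpenEmbedding_incl`). [cite: SchrammSmirnov2011, Thm. 1.4 (4)] -/
theorem continuous_restrict (hU : IsOpen U) (hUD : U ⊆ D) :
    Continuous (restrict hU hUD : QuadConfig D → QuadConfig U) := by
  refine continuous_generateFrom_iff.2 ?_
  rintro V (⟨W, hW, rfl⟩ | ⟨Q, rfl⟩)
  · rw [restrict_preimage_someCrossed]
    exact isOpen_someCrossed ((Quad.isOpenEmbedding_incl hU hUD).isOpenMap W hW)
  · rw [restrict_preimage_notCrossed]
    exact isOpen_notCrossed _

/-- The restriction is Borel measurable. [cite: SchrammSmirnov2011, Thm. 1.4 (4)] -/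
theorem measurable_restrict (hU : IsOpen U) (hUD : U ⊆ D) :
    Measurable (restrict hU hUD : QuadConfig D → QuadConfig U) :=
  (continuous_restrict hU hUD).measurable

/-- Restricting in two steps `D ⊇ U ⊇ V` is restricting to `V`. [folklore] -/
theorem restrict_restrict {V : Set ℂ} (hV : IsOpen V) (hVU : V ⊆ U) (hU : IsOpen U) (hUD : U ⊆ D)
    (S : QuadConfig D) :
    (S.restrict hU hUD).restrict hV hVU = S.restrict hV (hVU.trans hUD) := rfl

/-- **The sub-`σ`-field `𝓕_U := σ(⊞_Q : Q ∈ 𝒬_U)`** of the Borel `σ`-field of `ℋ_D`, generated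
by the crossing events of the quads of `D` lying in `U` ("Let `𝓕_D := σ(⊞_Q : Q ∈ 𝒬_D)` also
denote the corresponding subfield of the Borel `σ`-field of `ℋ_ℂ`").  Meaningful for `U ⊆ D`
(only `U ∩ D` matters: `crossingSubfield_inter`). [cite: SchrammSmirnov2011, §1.4 (p. 11, after Cor. 1.6)] -/
@[reducible] def crossingSubfield (U : Set ℂ) : MeasurableSpace (QuadConfig D) :=
  MeasurableSpace.generateFrom {A | ∃ Q : Quad D, Q.carrier ⊆ U ∧ A = crossedEvent Q}

/-- The generators of `𝓕_U`. [cite: SchrammSmirnov2011, §1.4] -/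
theorem measurableSet_crossingSubfield_crossedEvent {U : Set ℂ} {Q : Quad D}
    (hQ : Q.carrier ⊆ U) : MeasurableSet[crossingSubfield U] (crossedEvent Q) :=
  MeasurableSpace.measurableSet_generateFrom ⟨Q, hQ, rfl⟩

/-- `𝓕_U` is a sub-`σ`-field of the Borel `σ`-field. [cite: SchrammSmirnov2011, §1.4] -/
theorem crossingSubfield_le_borel (U : Set ℂ) :
    crossingSubfield (D := D) U ≤ borel (QuadConfig D) :=
  MeasurableSpace.generateFrom_le (by
    rintro _ ⟨Q, -, rfl⟩
    exact measurableSet_crossedEvent Q)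

/-- `𝓕_U` is monotone in `U`. [cite: SchrammSmirnov2011, §1.4] -/
theorem crossingSubfield_mono {U V : Set ℂ} (hUV : U ⊆ V) :
    crossingSubfield (D := D) U ≤ crossingSubfield V :=
  MeasurableSpace.generateFrom_mono (by
    rintro _ ⟨Q, hQ, rfl⟩
    exact ⟨Q, hQ.trans hUV, rfl⟩)

/-- Only `U ∩ D` matters (quads of `D` lie in `D`). [folklore] -/
theorem crossingSubfield_inter (U : Set ℂ) :
    crossingSubfield (D := D) (U ∩ D) = crossingSubfield U :=
  le_antisymm (crossingSubfield_mono inter_subset_left)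
    (MeasurableSpace.generateFrom_mono (by
      rintro _ ⟨Q, hQ, rfl⟩
      exact ⟨Q, subset_inter hQ Q.carrier_subset, rfl⟩))

/-- `𝓕_V` on `ℋ_D` is the pull-back of `𝓕_V` on `ℋ_U` under the restriction, `V ⊆ U ⊆ D`
(a quad of `D` inside `V` is a quad of `U`). [cite: SchrammSmirnov2011, Thm. 1.4 (4)] -/
theorem comap_restrict_crossingSubfield (hU : IsOpen U) (hUD : U ⊆ D) {V : Set ℂ} (hVU : V ⊆ U) :
    (crossingSubfield (D := U) V).comap (restrict hU hUD) = crossingSubfield (D := D) V := by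
  simp only [crossingSubfield, MeasurableSpace.comap_generateFrom]
  congr 1
  ext A
  constructor
  · rintro ⟨_, ⟨Q, hQ, rfl⟩, rfl⟩
    exact ⟨Q.incl hUD, hQ, rfl⟩
  · rintro ⟨Q, hQ, rfl⟩
    let QU : Quad U := ⟨Q.toFun, Q.continuous_toFun, Q.injective_toFun, hQ.trans hVU⟩
    exact ⟨crossedEvent QU, ⟨QU, hQ, rfl⟩, rfl⟩

/-- **"The Borel `σ`-field of `ℋ_D` is `σ(⊞_Q, Q ∈ 𝒬_D)`"** (from Thm. 1.4 (2), here the tree's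
named fact `SchrammSmirnov2011_thm_1_4`, for `D` open nonempty): `𝓕_D` on `ℋ_D` is the whole
Borel `σ`-field. [cite: SchrammSmirnov2011, Thm. 1.4 (2) and p. 11] -/
theorem crossingSubfield_univ_eq_borel (h14 : SchrammSmirnov2011_thm_1_4) (hD : IsOpen D)
    (hne : D.Nonempty) : crossingSubfield (D := D) univ = borel (QuadConfig D) := by
  refine le_antisymm (crossingSubfield_le_borel _) ?_
  rw [← ((h14 D hD hne).2 univ dense_univ).2]
  refine MeasurableSpace.generateFrom_le ?_
  rintro _ ⟨Q, -, rfl⟩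
  change MeasurableSet[crossingSubfield univ] (notCrossed Q)
  rw [← compl_crossedEvent]
  exact (measurableSet_crossingSubfield_crossedEvent (subset_univ _)).compl

end QuadConfig

/-! ### (b) Domain homeomorphisms -/

/-- **A homeomorphism of `D` onto `D'` given by plane maps**: a `PartialEquiv ℂ ℂ` with source
`D` and target `D'` whose two directions are continuous on `D`, resp. `D'` — the datum by which
quads (`Q ↦ h ∘ Q`), configurations and laws are transported between `ℋ_D` and `ℋ_{D'}`.
Instances: conformal (= injective holomorphic) maps of `D` onto `D'` (`ofConformalEquiv`), plane
homeomorphisms (`ofHomeomorph`), maps continuous and injective on a compact `K ⊇ D`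
(`ofInjOnCompact`).  Bundled exactly like the tree's `ConformalEquiv`.
[cite: GarbanPeteSchramm2013Pivotal, §2.3 (f(ω) for a conformal map f : Ω → Ω̃)] -/
structure DomainHomeomorph (D D' : Set ℂ) extends PartialEquiv ℂ ℂ where
  /-- The source of the underlying partial equivalence is `D`. -/
  source_eq : source = D
  /-- The target of the underlying partial equivalence is `D'`. -/
  target_eq : target = D'
  /-- The map is continuous on `D`. -/
  continuousOn_toFun : ContinuousOn toFun D
  /-- The inverse map is continuous on `D'`. -/
  continuousOn_invFun : ContinuousOn invFun D'

namespace DomainHomeomorph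

variable {D D' D'' : Set ℂ}

/-- The instance `instCoeFun` (see the module docstring). [folklore] -/
instance instCoeFun : CoeFun (DomainHomeomorph D D') fun _ => ℂ → ℂ := ⟨fun h => h.toPartialEquiv⟩

/-- `continuousOn`: structural lemma for the definitions above. [folklore] -/
theorem continuousOn (h : DomainHomeomorph D D') : ContinuousOn h D := h.continuousOn_toFun

/-- The inverse domain homeomorphism `D' → D`. [folklore] -/
@[symm]
def symm (h : DomainHomeomorph D D') : DomainHomeomorph D' D where
  toPartialEquiv := h.toPartialEquiv.symm
  source_eq := h.target_eq
  target_eq := h.source_eq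
  continuousOn_toFun := h.continuousOn_invFun
  continuousOn_invFun := h.continuousOn_toFun

/-- `symm_apply_eq`: structural lemma for the definitions above. [folklore] -/
theorem symm_apply_eq (h : DomainHomeomorph D D') (z : ℂ) : h.symm z = h.invFun z := rfl

/-- `symm_toPartialEquiv`: structural lemma for the definitions above. [folklore] -/
theorem symm_toPartialEquiv (h : DomainHomeomorph D D') :
    h.symm.toPartialEquiv = h.toPartialEquiv.symm := rfl

/-- `symm_symm`: structural lemma for the definitions above. [folklore] -/
@[simp] theorem symm_symm (h : DomainHomeomorph D D') : h.symm.symm = h := rfl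

/-- `mapsTo`: structural lemma for the definitions above. [folklore] -/
theorem mapsTo (h : DomainHomeomorph D D') : MapsTo h D D' := by
  have h' := h.toPartialEquiv.mapsTo
  rwa [h.source_eq, h.target_eq] at h'

/-- `symm_mapsTo`: structural lemma for the definitions above. [folklore] -/
theorem symm_mapsTo (h : DomainHomeomorph D D') : MapsTo h.symm D' D := h.symm.mapsTo

/-- `apply_mem`: structural lemma for the definitions above. [folklore] -/
theorem apply_mem (h : DomainHomeomorph D D') {z : ℂ} (hz : z ∈ D) : h z ∈ D' := h.mapsTo hz

/-- `symm_apply_apply`: structural lemma for the definitions above. [folklore] -/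
@[simp] theorem symm_apply_apply (h : DomainHomeomorph D D') {z : ℂ} (hz : z ∈ D) :
    h.symm (h z) = z :=
  h.toPartialEquiv.left_inv (h.source_eq.symm ▸ hz)

/-- `apply_symm_apply`: structural lemma for the definitions above. [folklore] -/
@[simp] theorem apply_symm_apply (h : DomainHomeomorph D D') {w : ℂ} (hw : w ∈ D') :
    h (h.symm w) = w :=
  h.toPartialEquiv.right_inv (h.target_eq.symm ▸ hw)

/-- `injOn`: structural lemma for the definitions above. [folklore] -/
theorem injOn (h : DomainHomeomorph D D') : InjOn h D := by
  have h' := h.toPartialEquiv.injOn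
  rwa [h.source_eq] at h'

/-- `bijOn`: structural lemma for the definitions above. [folklore] -/
theorem bijOn (h : DomainHomeomorph D D') : BijOn h D D' := by
  have h' := h.toPartialEquiv.bijOn
  rwa [h.source_eq, h.target_eq] at h'

/-- `h(D) = D'`. [folklore] -/
theorem image_eq (h : DomainHomeomorph D D') : h '' D = D' := h.bijOn.image_eq

/-- `symm_image_eq`: structural lemma for the definitions above. [folklore] -/
theorem symm_image_eq (h : DomainHomeomorph D D') : h.symm '' D' = D := h.symm.image_eq

/-- `symm_image_image`: structural lemma for the definitions above. [folklore] -/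
theorem symm_image_image (h : DomainHomeomorph D D') {A : Set ℂ} (hA : A ⊆ D) :
    h.symm '' (h '' A) = A :=
  h.toPartialEquiv.symm_image_image_of_subset_source (h.source_eq.symm ▸ hA)

/-- `image_symm_image`: structural lemma for the definitions above. [folklore] -/
theorem image_symm_image (h : DomainHomeomorph D D') {B : Set ℂ} (hB : B ⊆ D') :
    h '' (h.symm '' B) = B :=
  h.symm.symm_image_image hB

/-- `image_subset`: structural lemma for the definitions above. [folklore] -/
theorem image_subset (h : DomainHomeomorph D D') {A : Set ℂ} (hA : A ⊆ D) : h '' A ⊆ D' :=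
  (image_mono hA).trans_eq h.image_eq

/-- The identity of `D`. [folklore] -/
@[refl]
def refl (D : Set ℂ) : DomainHomeomorph D D where
  toPartialEquiv := PartialEquiv.ofSet D
  source_eq := rfl
  target_eq := rfl
  continuousOn_toFun := continuousOn_id
  continuousOn_invFun := continuousOn_id

/-- `refl_apply`: structural lemma for the definitions above. [folklore] -/
@[simp] theorem refl_apply (D : Set ℂ) (z : ℂ) : refl D z = z := rfl

/-- `refl_symm`: structural lemma for the definitions above. [folklore] -/
@[simp] theorem refl_symm (D : Set ℂ) : (refl D).symm = refl D := rfl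

/-- Composition `D → D' → D''`. [folklore] -/
@[trans]
def trans (h : DomainHomeomorph D D') (g : DomainHomeomorph D' D'') : DomainHomeomorph D D'' where
  toPartialEquiv := h.toPartialEquiv.trans' g.toPartialEquiv (h.target_eq.trans g.source_eq.symm)
  source_eq := h.source_eq
  target_eq := g.target_eq
  continuousOn_toFun := g.continuousOn.comp h.continuousOn h.mapsTo
  continuousOn_invFun := h.symm.continuousOn.comp g.symm.continuousOn g.symm_mapsTo

/-- `trans_apply`: structural lemma for the definitions above. [folklore] -/
@[simp] theorem trans_apply (h : DomainHomeomorph D D') (g : DomainHomeomorph D' D'') (z : ℂ) :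
    h.trans g z = g (h z) := rfl

/-- `trans_symm_apply`: structural lemma for the definitions above. [folklore] -/
@[simp] theorem trans_symm_apply (h : DomainHomeomorph D D') (g : DomainHomeomorph D' D'')
    (w : ℂ) : (h.trans g).symm w = h.symm (g.symm w) := rfl

/-- The restriction of `h` to `U ⊆ D`, a domain homeomorphism of `U` onto `h(U)`. [folklore] -/
def restr (h : DomainHomeomorph D D') {U : Set ℂ} (hU : U ⊆ D) : DomainHomeomorph U (h '' U) where
  toFun := h
  invFun := h.symm
  source := U
  target := h '' U
  map_source' := fun _ hz => mem_image_of_mem _ hz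
  map_target' := by
    rintro _ ⟨z, hz, rfl⟩
    rwa [h.symm_apply_apply (hU hz)]
  left_inv' := fun _ hz => h.symm_apply_apply (hU hz)
  right_inv' := by
    rintro _ ⟨z, hz, rfl⟩
    rw [h.symm_apply_apply (hU hz)]
  source_eq := rfl
  target_eq := rfl
  continuousOn_toFun := h.continuousOn.mono hU
  continuousOn_invFun := h.symm.continuousOn.mono (h.image_subset hU)

/-- `restr_apply`: structural lemma for the definitions above. [folklore] -/
@[simp] theorem restr_apply (h : DomainHomeomorph D D') {U : Set ℂ} (hU : U ⊆ D) (z : ℂ) :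
    h.restr hU z = h z := rfl

/-- `restr_symm_apply`: structural lemma for the definitions above. [folklore] -/
@[simp] theorem restr_symm_apply (h : DomainHomeomorph D D') {U : Set ℂ} (hU : U ⊆ D) (w : ℂ) :
    (h.restr hU).symm w = h.symm w := rfl

/-- **A conformal map of `D` onto `D'`** (an injective holomorphic map with holomorphic inverse,
the tree's `ConformalEquiv D D'`) is a domain homeomorphism. [cite: GarbanPeteSchramm2013Pivotal, §2.3] -/
def ofConformalEquiv (φ : RandomPlanarGeometry.ConformalEquiv D D') : DomainHomeomorph D D' where
  toPartialEquiv := φ.toPartialEquiv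
  source_eq := φ.source_eq
  target_eq := φ.target_eq
  continuousOn_toFun := φ.continuousOn
  continuousOn_invFun := φ.symm.continuousOn

/-- `ofConformalEquiv_apply`: structural lemma for the definitions above. [folklore] -/
@[simp] theorem ofConformalEquiv_apply (φ : RandomPlanarGeometry.ConformalEquiv D D') (z : ℂ) :
    ofConformalEquiv φ z = φ z := rfl

/-- `ofConformalEquiv_symm`: structural lemma for the definitions above. [folklore] -/
theorem ofConformalEquiv_symm (φ : RandomPlanarGeometry.ConformalEquiv D D') :
    (ofConformalEquiv φ).symm = ofConformalEquiv φ.symm := rfl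

/-- **A plane homeomorphism `e` with `e(D) = D'`** (e.g. a dilation, a Euclidean motion) is a
domain homeomorphism of `D` onto `D'`. [folklore] -/
def ofHomeomorph (e : ℂ ≃ₜ ℂ) (hD : e '' D = D') : DomainHomeomorph D D' where
  toPartialEquiv := e.toEquiv.toPartialEquivOfImageEq D D' hD
  source_eq := rfl
  target_eq := rfl
  continuousOn_toFun := e.continuous.continuousOn
  continuousOn_invFun := e.symm.continuous.continuousOn

/-- `ofHomeomorph_apply`: structural lemma for the definitions above. [folklore] -/
@[simp] theorem ofHomeomorph_apply (e : ℂ ≃ₜ ℂ) (hD : e '' D = D') (z : ℂ) :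
    ofHomeomorph e hD z = e z := rfl

/-- `ofHomeomorph_symm_apply`: structural lemma for the definitions above. [folklore] -/
@[simp] theorem ofHomeomorph_symm_apply (e : ℂ ≃ₜ ℂ) (hD : e '' D = D') (w : ℂ) :
    (ofHomeomorph e hD).symm w = e.symm w := rfl

/-- A map continuous and injective on a compact set `K` has an inverse continuous on `f(K)`
(`f|K` is a closed map). [folklore] -/
theorem continuousOn_invFunOn_of_isCompact {f : ℂ → ℂ} {K : Set ℂ} (hK : IsCompact K)
    (hf : ContinuousOn f K) (hinj : InjOn f K) : ContinuousOn (Function.invFunOn f K) (f '' K) := by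
  rw [continuousOn_iff_isClosed]
  intro t ht
  refine ⟨f '' (t ∩ K), ((hK.inter_left ht).image_of_continuousOn (hf.mono inter_subset_right)).isClosed,
    ?_⟩
  ext w
  constructor
  · rintro ⟨hw, z, hz, rfl⟩
    rw [mem_preimage, hinj.leftInvOn_invFunOn hz] at hw
    exact ⟨⟨z, ⟨hw, hz⟩, rfl⟩, z, hz, rfl⟩
  · rintro ⟨⟨z, ⟨hzt, hzK⟩, rfl⟩, -⟩
    refine ⟨?_, z, hzK, rfl⟩
    rw [mem_preimage, hinj.leftInvOn_invFunOn hzK]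
    exact hzt

/-- **A map continuous and injective on a compact `K ⊇ D`** is a domain homeomorphism of `D` onto
`f(D)` (inverse `Function.invFunOn f K`, continuous on `f(K) ⊇ f(D)`).  E.g. the bending
`φ_ε(z) = z + εz³` (`ε < 1/12`) on the closed unit disc `K ⊇ 𝔻 = D`, as in route
`CardyBlackNoise`. [folklore] -/
def ofInjOnCompact (f : ℂ → ℂ) {K : Set ℂ} (hK : IsCompact K) (hf : ContinuousOn f K)
    (hinj : InjOn f K) (hDK : D ⊆ K) : DomainHomeomorph D (f '' D) where
  toFun := f
  invFun := Function.invFunOn f K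
  source := D
  target := f '' D
  map_source' := fun _ hz => mem_image_of_mem f hz
  map_target' := by
    rintro _ ⟨z, hz, rfl⟩
    rwa [hinj.leftInvOn_invFunOn (hDK hz)]
  left_inv' := fun _ hz => hinj.leftInvOn_invFunOn (hDK hz)
  right_inv' := by
    rintro _ ⟨z, hz, rfl⟩
    rw [hinj.leftInvOn_invFunOn (hDK hz)]
  source_eq := rfl
  target_eq := rfl
  continuousOn_toFun := hf.mono hDK
  continuousOn_invFun := (continuousOn_invFunOn_of_isCompact hK hf hinj).mono (image_mono hDK)

/-- `ofInjOnCompact_apply`: structural lemma for the definitions above. [folklore] -/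
@[simp] theorem ofInjOnCompact_apply (f : ℂ → ℂ) {K : Set ℂ} (hK : IsCompact K)
    (hf : ContinuousOn f K) (hinj : InjOn f K) (hDK : D ⊆ K) (z : ℂ) :
    ofInjOnCompact f hK hf hinj hDK z = f z := rfl

end DomainHomeomorph

/-! ### (b) Quads under a domain homeomorphism: `Q ↦ h ∘ Q` -/

namespace Quad

variable {D D' D'' : Set ℂ}

/-- **The image `h ∘ Q ∈ 𝒬_{D'}` of a quad of `D`** under a domain homeomorphism (continuous and
injective on `D ⊇ [Q]`). [cite: GarbanPeteSchramm2013Pivotal, §2.3] -/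
def mapDomain (h : DomainHomeomorph D D') (Q : Quad D) : Quad D' where
  toFun := h ∘ Q
  continuous_toFun := h.continuousOn.comp_continuous Q.continuous_toFun Q.apply_mem
  injective_toFun := fun z w hzw =>
    Q.injective_toFun (h.injOn (Q.apply_mem z) (Q.apply_mem w) hzw)
  range_subset := by
    rintro _ ⟨z, rfl⟩
    exact h.mapsTo (Q.apply_mem z)

variable (h : DomainHomeomorph D D')

/-- `mapDomain_apply`: structural lemma for the definitions above. [folklore] -/
@[simp] theorem mapDomain_apply (Q : Quad D) (z : I × I) : Q.mapDomain h z = h (Q z) := rfl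

/-- `mapDomain_symm_mapDomain`: structural lemma for the definitions above. [folklore] -/
@[simp] theorem mapDomain_symm_mapDomain (Q : Quad D) : (Q.mapDomain h).mapDomain h.symm = Q := by
  ext z
  simp [Q.apply_mem z]

/-- `mapDomain_mapDomain_symm`: structural lemma for the definitions above. [folklore] -/
@[simp] theorem mapDomain_mapDomain_symm (Q' : Quad D') :
    (Q'.mapDomain h.symm).mapDomain h = Q' := by
  ext z
  simp [Q'.apply_mem z]

/-- Functoriality on quads: `(g ∘ h) ∘ Q = g ∘ (h ∘ Q)`. [folklore] -/
theorem mapDomain_trans (g : DomainHomeomorph D' D'') (Q : Quad D) :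
    Q.mapDomain (h.trans g) = (Q.mapDomain h).mapDomain g :=
  Quad.ext fun _ => rfl

/-- `mapDomain_trans_symm`: structural lemma for the definitions above. [folklore] -/
theorem mapDomain_trans_symm (g : DomainHomeomorph D' D'') (Q'' : Quad D'') :
    Q''.mapDomain (h.trans g).symm = (Q''.mapDomain g.symm).mapDomain h.symm :=
  Quad.ext fun _ => rfl

/-- `mapDomain_refl`: structural lemma for the definitions above. [folklore] -/
@[simp] theorem mapDomain_refl (Q : Quad D) : Q.mapDomain (DomainHomeomorph.refl D) = Q :=
  Quad.ext fun _ => rfl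

/-- The plane-homeomorphism action of `QuadCrossingSpace.lean` is the case `D = D' = ℂ`. [folklore] -/
theorem mapDomain_ofHomeomorph (e : ℂ ≃ₜ ℂ) (he : e '' (univ : Set ℂ) = univ)
    (Q : Quad (univ : Set ℂ)) :
    Q.mapDomain (DomainHomeomorph.ofHomeomorph e he) = Q.mapHomeomorph e :=
  Quad.ext fun _ => rfl

/-- A quad of `D`, corestricted to a continuous map into the subtype `D`. [folklore] -/
def codRestrictCM (Q : Quad D) : C(I × I, D) :=
  ⟨Set.codRestrict Q D Q.apply_mem, Q.continuous_toFun.codRestrict Q.apply_mem⟩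

/-- `codRestrictCM_apply`: structural lemma for the definitions above. [folklore] -/
@[simp] theorem codRestrictCM_apply (Q : Quad D) (z : I × I) : (Q.codRestrictCM z : ℂ) = Q z := rfl

/-- `Q ↦ Q` as a map `𝒬_D → C([0,1]², D)` is continuous (the uniform topology of `𝒬_D` is induced
from `C([0,1]², ℂ)`, into which `C([0,1]², D)` embeds, `ContinuousMap.isInducing_postcomp`). [folklore] -/
theorem continuous_codRestrictCM : Continuous (codRestrictCM : Quad D → C(I × I, D)) := by
  have hval : IsInducing
      (ContinuousMap.comp ⟨Subtype.val, continuous_subtype_val⟩ : C(I × I, D) → C(I × I, ℂ)) :=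
    ContinuousMap.isInducing_postcomp _ IsInducing.subtypeVal
  refine hval.continuous_iff.2 ?_
  have : (ContinuousMap.comp ⟨Subtype.val, continuous_subtype_val⟩ : C(I × I, D) → C(I × I, ℂ)) ∘
      codRestrictCM = toContinuousMap (D := D) := by
    funext Q; ext z; rfl
  rw [this]
  exact continuous_toContinuousMap

/-- **`Q ↦ h ∘ Q` is continuous in the uniform metric** although `h` is only continuous on `D`:
it factors as `𝒬_D → C([0,1]², D) → C([0,1]², ℂ)`, post-composition with the continuous
`h|D : D → ℂ`. [folklore] -/
theorem continuous_mapDomain : Continuous (mapDomain h : Quad D → Quad D') := by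
  refine continuous_induced_rng.2 ?_
  have : toContinuousMap ∘ mapDomain h =
      (ContinuousMap.comp ⟨D.restrict h, h.continuousOn.restrict⟩ : C(I × I, D) → C(I × I, ℂ)) ∘
        codRestrictCM := by
    funext Q; ext z; rfl
  rw [this]
  exact (ContinuousMap.continuous_postcomp _).comp continuous_codRestrictCM

/-- **The homeomorphism `𝒬_D ≃ₜ 𝒬_{D'}`, `Q ↦ h ∘ Q`**, with inverse `Q' ↦ h⁻¹ ∘ Q'`. [folklore] -/
def domainCongr : Quad D ≃ₜ Quad D' where
  toFun := mapDomain h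
  invFun := mapDomain h.symm
  left_inv := mapDomain_symm_mapDomain h
  right_inv := mapDomain_mapDomain_symm h
  continuous_toFun := continuous_mapDomain h
  continuous_invFun := continuous_mapDomain h.symm

/-- `domainCongr_apply`: structural lemma for the definitions above. [folklore] -/
@[simp] theorem domainCongr_apply (Q : Quad D) : domainCongr h Q = Q.mapDomain h := rfl

/-- `domainCongr_symm_apply`: structural lemma for the definitions above. [folklore] -/
@[simp] theorem domainCongr_symm_apply (Q' : Quad D') :
    (domainCongr h).symm Q' = Q'.mapDomain h.symm := rfl

/-- `[h ∘ Q] = h([Q])`. [folklore] -/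
theorem carrier_mapDomain (Q : Quad D) : (Q.mapDomain h).carrier = h '' Q.carrier :=
  Set.range_comp h Q.toFun

/-- `∂ₖ(h ∘ Q) = h(∂ₖQ)`. [folklore] -/
theorem side_mapDomain (Q : Quad D) (k : Fin 4) : (Q.mapDomain h).side k = h '' Q.side k := by
  match k with
  | 0 => exact Set.image_comp h Q.toFun _
  | 1 => exact Set.image_comp h Q.toFun _
  | 2 => exact Set.image_comp h Q.toFun _
  | 3 => exact Set.image_comp h Q.toFun _

/-- Domain homeomorphisms carry crossings to crossings (a crossing lies in `[Q] ⊆ D`, where `h`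
is continuous and injective). [folklore] -/
theorem IsCrossing.mapDomain {Q : Quad D} {K : Set ℂ} (hK : Q.IsCrossing K) :
    (Q.mapDomain h).IsCrossing (h '' K) := by
  obtain ⟨hc, hconn, hsub, h0, h2⟩ := hK
  have hKD : K ⊆ D := hsub.trans Q.carrier_subset
  refine ⟨hc.image_of_continuousOn (h.continuousOn.mono hKD),
    hconn.image h (h.continuousOn.mono hKD), ?_, ?_, ?_⟩
  · rw [carrier_mapDomain]
    exact image_mono hsub
  · rw [side_mapDomain]
    exact (h0.image h).mono (image_inter_subset h K _)
  · rw [side_mapDomain]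
    exact (h2.image h).mono (image_inter_subset h K _)

/-- The crossings of `h ∘ Q` are the images of the crossings of `Q`. [folklore] -/
theorem isCrossing_mapDomain_iff {Q : Quad D} {K' : Set ℂ} :
    (Q.mapDomain h).IsCrossing K' ↔ K' ⊆ D' ∧ Q.IsCrossing (h.symm '' K') := by
  constructor
  · intro hK'
    have hK'D' : K' ⊆ D' := hK'.2.2.1.trans (Q.mapDomain h).carrier_subset
    refine ⟨hK'D', ?_⟩
    simpa only [mapDomain_symm_mapDomain] using hK'.mapDomain h.symm
  · rintro ⟨hK'D', hK⟩
    have h' := hK.mapDomain h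
    rwa [h.image_symm_image hK'D'] at h'

/-- Domain homeomorphisms preserve the order `≤` of quads. [folklore] -/
theorem Dominated.mapDomain {Q₁ Q₂ : Quad D} (hd : Dominated Q₁ Q₂) :
    Dominated (Q₁.mapDomain h) (Q₂.mapDomain h) := by
  intro K' hK'
  obtain ⟨hK'D', hK⟩ := (isCrossing_mapDomain_iff h).1 hK'
  obtain ⟨K, hKK, hK₁⟩ := hd _ hK
  refine ⟨h '' K, ?_, hK₁.mapDomain h⟩
  calc h '' K ⊆ h '' (h.symm '' K') := image_mono hKK
    _ = K' := h.image_symm_image hK'D'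

/-- `dominated_mapDomain_iff`: structural lemma for the definitions above. [folklore] -/
theorem dominated_mapDomain_iff {Q₁ Q₂ : Quad D} :
    Dominated (Q₁.mapDomain h) (Q₂.mapDomain h) ↔ Dominated Q₁ Q₂ :=
  ⟨fun hd => by simpa only [mapDomain_symm_mapDomain] using hd.mapDomain h.symm,
    fun hd => hd.mapDomain h⟩

/-- Domain homeomorphisms preserve the strict order `<` of quads (`h × h` is a homeomorphism
`𝒬_D² ≃ₜ 𝒬_{D'}²` mapping `≤` onto `≤`, hence its interior onto its interior). [folklore] -/
theorem StrictlyDominated.mapDomain {Q₁ Q₂ : Quad D} (hs : StrictlyDominated Q₁ Q₂) :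
    StrictlyDominated (Q₁.mapDomain h) (Q₂.mapDomain h) := by
  let Φ : Quad D × Quad D ≃ₜ Quad D' × Quad D' := (domainCongr h).prodCongr (domainCongr h)
  have hR : Φ '' {p : Quad D × Quad D | Dominated p.1 p.2} =
      {p : Quad D' × Quad D' | Dominated p.1 p.2} := by
    ext p
    constructor
    · rintro ⟨q, hq, rfl⟩
      exact (Dominated.mapDomain h hq :)
    · intro hp
      refine ⟨(p.1.mapDomain h.symm, p.2.mapDomain h.symm), Dominated.mapDomain h.symm hp, ?_⟩
      exact Prod.ext (mapDomain_mapDomain_symm h p.1) (mapDomain_mapDomain_symm h p.2)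
  have key := (Φ.image_interior {p : Quad D × Quad D | Dominated p.1 p.2}).symm
  rw [hR] at key
  change Φ (Q₁, Q₂) ∈ interior {p : Quad D' × Quad D' | Dominated p.1 p.2}
  rw [key]
  exact mem_image_of_mem Φ hs

/-- `strictlyDominated_mapDomain_iff`: structural lemma for the definitions above. [folklore] -/
theorem strictlyDominated_mapDomain_iff {Q₁ Q₂ : Quad D} :
    StrictlyDominated (Q₁.mapDomain h) (Q₂.mapDomain h) ↔ StrictlyDominated Q₁ Q₂ :=
  ⟨fun hs => by simpa only [mapDomain_symm_mapDomain] using hs.mapDomain h.symm,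
    fun hs => hs.mapDomain h⟩

end Quad

/-! ### (b) Configurations under a domain homeomorphism: `h_* : ℋ_D → ℋ_{D'}` -/

namespace QuadConfig

variable {D D' D'' : Set ℂ} (h : DomainHomeomorph D D')

/-- **`h_* S = h(S) := {h ∘ Q : Q ∈ S} ∈ ℋ_{D'}`**, the image configuration ("`ω̃ := f(ω)`,
defined by `⊞_{f(Q)}(ω̃) := ⊞_Q(ω)`"): a closed lower set, being the image of the closed set `S`
under the homeomorphism `Q ↦ h ∘ Q` of quad spaces, lower by `<`-invariance.
[cite: GarbanPeteSchramm2013Pivotal, §2.3] -/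
def mapDomain (S : QuadConfig D) : QuadConfig D' :=
  ⟨Quad.domainCongr h '' (S : Set (Quad D)), (Quad.domainCongr h).isClosed_image.2 S.isClosed, by
    rintro _ ⟨Q, hQ, rfl⟩ Q' hlt
    refine ⟨Q'.mapDomain h.symm, S.isLowerQuadSet hQ ?_, ?_⟩
    · simpa only [Quad.domainCongr_apply, Quad.mapDomain_symm_mapDomain] using
        hlt.mapDomain h.symm
    · simp⟩

/-- `coe_mapDomain`: structural lemma for the definitions above. [folklore] -/
theorem coe_mapDomain (S : QuadConfig D) :
    (S.mapDomain h : Set (Quad D')) = Quad.domainCongr h '' (S : Set (Quad D)) := rfl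

/-- `h ∘ Q'' ∈ h_* S ↔ Q'' ∈ S`, in the form `Q' ∈ h_* S ↔ h⁻¹ ∘ Q' ∈ S`. [cite: GarbanPeteSchramm2013Pivotal, §2.3] -/
@[simp] theorem mem_mapDomain {S : QuadConfig D} {Q' : Quad D'} :
    Q' ∈ S.mapDomain h ↔ Q'.mapDomain h.symm ∈ S := by
  change Q' ∈ Quad.domainCongr h '' (S : Set (Quad D)) ↔ _
  constructor
  · rintro ⟨Q, hQ, rfl⟩
    simpa using hQ
  · intro hQ'
    exact ⟨_, hQ', by simp⟩

/-- **GPS's defining identity `⊞_{h∘Q}(h_* S) ↔ ⊞_Q(S)`.** [cite: GarbanPeteSchramm2013Pivotal, §2.3] -/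
theorem mapDomain_mem_crossedEvent_iff {S : QuadConfig D} {Q : Quad D} :
    S.mapDomain h ∈ crossedEvent (Q.mapDomain h) ↔ S ∈ crossedEvent Q := by
  simp

/-- `mapDomain_symm_mapDomain`: structural lemma for the definitions above. [folklore] -/
@[simp] theorem mapDomain_symm_mapDomain (S : QuadConfig D) :
    (S.mapDomain h).mapDomain h.symm = S := by
  ext Q
  simp

/-- `mapDomain_mapDomain_symm`: structural lemma for the definitions above. [folklore] -/
@[simp] theorem mapDomain_mapDomain_symm (S' : QuadConfig D') :
    (S'.mapDomain h.symm).mapDomain h = S' := by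
  ext Q
  simp

/-- **Functoriality `(g ∘ h)_* = g_* ∘ h_*`.** [folklore] -/
theorem mapDomain_trans (g : DomainHomeomorph D' D'') (S : QuadConfig D) :
    S.mapDomain (h.trans g) = (S.mapDomain h).mapDomain g := by
  ext Q
  simp only [mem_mapDomain, Quad.mapDomain_trans_symm]

/-- **Functoriality `(id_D)_* = id`.** [folklore] -/
@[simp] theorem mapDomain_refl (S : QuadConfig D) : S.mapDomain (DomainHomeomorph.refl D) = S := by
  ext Q
  simp only [mem_mapDomain, DomainHomeomorph.refl_symm, Quad.mapDomain_refl]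

/-- `h_*` is monotone (for inclusion of configurations). [folklore] -/
theorem mapDomain_mono : Monotone (mapDomain h) := fun _ _ hST _ hQ =>
  (mem_mapDomain h).2 (hST ((mem_mapDomain h).1 hQ))

/-- The plane-homeomorphism action of `QuadCrossingSpace.lean` is the case `D = D' = ℂ`. [folklore] -/
theorem mapDomain_ofHomeomorph (e : ℂ ≃ₜ ℂ) (he : e '' (univ : Set ℂ) = univ)
    (S : QuadConfig (univ : Set ℂ)) :
    S.mapDomain (DomainHomeomorph.ofHomeomorph e he) = S.mapHomeomorph e := by
  ext Q
  rw [mem_mapDomain, mem_mapHomeomorph]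
  exact Iff.of_eq (congrArg (· ∈ S) (Quad.ext fun _ => rfl))

/-- `mapDomain_preimage_notCrossed`: structural lemma for the definitions above. [folklore] -/
theorem mapDomain_preimage_notCrossed (Q' : Quad D') :
    mapDomain h ⁻¹' notCrossed Q' = notCrossed (Q'.mapDomain h.symm) := by
  ext S
  simp [notCrossed]

/-- `h_*⁻¹(⊞_{Q'}) = ⊞_{h⁻¹∘Q'}`. [cite: GarbanPeteSchramm2013Pivotal, §2.3] -/
theorem mapDomain_preimage_crossedEvent (Q' : Quad D') :
    mapDomain h ⁻¹' crossedEvent Q' = crossedEvent (Q'.mapDomain h.symm) := by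
  ext S
  simp

/-- `h_*(⊞_Q) = ⊞_{h∘Q}`. [cite: GarbanPeteSchramm2013Pivotal, §2.3] -/
theorem mapDomain_image_crossedEvent (Q : Quad D) :
    mapDomain h '' crossedEvent Q = crossedEvent (Q.mapDomain h) := by
  ext S'
  constructor
  · rintro ⟨S, hS, rfl⟩
    simpa using hS
  · intro hS'
    refine ⟨S'.mapDomain h.symm, ?_, mapDomain_mapDomain_symm h S'⟩
    simpa using hS'

/-- `mapDomain_preimage_someCrossed`: structural lemma for the definitions above. [folklore] -/
theorem mapDomain_preimage_someCrossed (V : Set (Quad D')) :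
    mapDomain h ⁻¹' someCrossed V = someCrossed (Quad.mapDomain h ⁻¹' V) := by
  ext S
  simp only [mem_preimage, someCrossed, mem_setOf_eq]
  constructor
  · rintro ⟨Q', hQ'S, hQ'V⟩
    refine ⟨Q'.mapDomain h.symm, (mem_mapDomain h).1 hQ'S, ?_⟩
    simpa using hQ'V
  · rintro ⟨Q, hQS, hQV⟩
    exact ⟨Q.mapDomain h, (mem_mapDomain h).2 (by simpa using hQS), hQV⟩

/-- **`h_* : ℋ_D → ℋ_{D'}` is continuous** (preimages of subbasic sets are subbasic:
`V^{Q'} ↦ V^{h⁻¹∘Q'}`, `V_W ↦ V_{(h∘·)⁻¹ W}`). [cite: GarbanPeteSchramm2013Pivotal, §2.3] -/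
theorem continuous_mapDomain : Continuous (mapDomain h : QuadConfig D → QuadConfig D') := by
  refine continuous_generateFrom_iff.2 ?_
  rintro V (⟨W, hW, rfl⟩ | ⟨Q', rfl⟩)
  · rw [mapDomain_preimage_someCrossed]
    exact isOpen_someCrossed (hW.preimage (Quad.continuous_mapDomain h))
  · rw [mapDomain_preimage_notCrossed]
    exact isOpen_notCrossed _

/-- **The homeomorphism `h_* : ℋ_D ≃ₜ ℋ_{D'}`** (inverse `(h⁻¹)_*`). [cite: GarbanPeteSchramm2013Pivotal, §2.3] -/
def domainCongr : QuadConfig D ≃ₜ QuadConfig D' where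
  toFun := mapDomain h
  invFun := mapDomain h.symm
  left_inv := mapDomain_symm_mapDomain h
  right_inv := mapDomain_mapDomain_symm h
  continuous_toFun := continuous_mapDomain h
  continuous_invFun := continuous_mapDomain h.symm

/-- `domainCongr_apply`: structural lemma for the definitions above. [folklore] -/
@[simp] theorem domainCongr_apply (S : QuadConfig D) : domainCongr h S = S.mapDomain h := rfl

/-- `domainCongr_symm_apply`: structural lemma for the definitions above. [folklore] -/
@[simp] theorem domainCongr_symm_apply (S' : QuadConfig D') :
    (domainCongr h).symm S' = S'.mapDomain h.symm := rfl

/-- `h_*` is Borel measurable. [cite: GarbanPeteSchramm2013Pivotal, §2.3] -/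
theorem measurable_mapDomain : Measurable (mapDomain h : QuadConfig D → QuadConfig D') :=
  (continuous_mapDomain h).measurable

/-- `h_*` is a measurable embedding (a Borel isomorphism onto `ℋ_{D'}`). [folklore] -/
theorem measurableEmbedding_mapDomain :
    MeasurableEmbedding (mapDomain h : QuadConfig D → QuadConfig D') :=
  (domainCongr h).measurableEmbedding

/-- `h_*` is measurable from `𝓕_U` to `𝓕_{h(U)}` (`U ⊆ D`): `h_*⁻¹(⊞_{Q'}) = ⊞_{h⁻¹∘Q'}` and
`[h⁻¹ ∘ Q'] = h⁻¹([Q']) ⊆ U`. [cite: SchrammSmirnov2011, §1.4] -/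
theorem measurable_mapDomain_crossingSubfield {U : Set ℂ} (hU : U ⊆ D) :
    @Measurable _ _ (crossingSubfield U) (crossingSubfield (h '' U)) (mapDomain h) := by
  refine @measurable_generateFrom _ _ (crossingSubfield U) _ _ ?_
  rintro _ ⟨Q', hQ', rfl⟩
  rw [mapDomain_preimage_crossedEvent]
  refine measurableSet_crossingSubfield_crossedEvent ?_
  rw [Quad.carrier_mapDomain]
  calc h.symm '' Q'.carrier ⊆ h.symm '' (h '' U) := image_mono hQ'
    _ = U := h.symm_image_image hU

/-- **`h_*(𝓕_U) = 𝓕_{h(U)}`** for `U ⊆ D`: the image `σ`-field `{A : h_*⁻¹(A) ∈ 𝓕_U}` of `𝓕_U`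
under the bijection `h_*` is the crossing `σ`-field of `h(U)` in `ℋ_{D'}`. [cite: SchrammSmirnov2011, §1.4; GarbanPeteSchramm2013Pivotal, §2.3] -/
theorem map_mapDomain_crossingSubfield {U : Set ℂ} (hU : U ⊆ D) :
    (crossingSubfield U).map (mapDomain h) = crossingSubfield (D := D') (h '' U) := by
  have hfwd := measurable_mapDomain_crossingSubfield h hU
  have hbwd : @Measurable _ _ (crossingSubfield (h '' U)) (crossingSubfield U) (mapDomain h.symm) := by
    have := measurable_mapDomain_crossingSubfield h.symm (h.image_subset hU)
    rwa [h.symm_image_image hU] at this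
  refine le_antisymm ?_ ?_
  · intro A hA
    have hA' : A = mapDomain h.symm ⁻¹' (mapDomain h ⁻¹' A) := by
      ext S'
      simp only [mem_preimage, mapDomain_mapDomain_symm]
    rw [hA']
    exact hbwd (MeasurableSpace.map_def.1 hA)
  · intro A hA
    exact MeasurableSpace.map_def.2 (hfwd hA)

end QuadConfig

/-! ### (b) Push-forward of laws -/

section Laws

variable {D D' D'' : Set ℂ} (h : DomainHomeomorph D D')

/-- **The push-forward `(h_*)_# μ` of a (finite Borel) law on `ℋ_D`** to a law on `ℋ_{D'}`.
[cite: GarbanPeteSchramm2013Pivotal, §2.3] -/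
def mapLaw (μ : FiniteMeasure (QuadConfig D)) : FiniteMeasure (QuadConfig D') :=
  μ.map (QuadConfig.mapDomain h)

/-- `toMeasure_mapLaw`: structural lemma for the definitions above. [folklore] -/
@[simp] theorem toMeasure_mapLaw (μ : FiniteMeasure (QuadConfig D)) :
    (mapLaw h μ : Measure (QuadConfig D')) = (μ : Measure (QuadConfig D)).map (QuadConfig.mapDomain h) :=
  rfl

/-- `(h_*)_# μ (A) = μ (h_*⁻¹ A)` for Borel `A`. [folklore] -/
theorem mapLaw_apply (μ : FiniteMeasure (QuadConfig D)) {A : Set (QuadConfig D')}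
    (hA : MeasurableSet A) : mapLaw h μ A = μ (QuadConfig.mapDomain h ⁻¹' A) :=
  FiniteMeasure.map_apply μ (QuadConfig.measurable_mapDomain h) hA

/-- In particular `(h_*)_# μ (⊞_{h∘Q}) = μ (⊞_Q)`. [cite: GarbanPeteSchramm2013Pivotal, §2.3] -/
theorem mapLaw_apply_crossedEvent (μ : FiniteMeasure (QuadConfig D)) (Q : Quad D) :
    mapLaw h μ (QuadConfig.crossedEvent (Q.mapDomain h)) = μ (QuadConfig.crossedEvent Q) := by
  rw [mapLaw_apply h μ (QuadConfig.measurableSet_crossedEvent _),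
    QuadConfig.mapDomain_preimage_crossedEvent, Quad.mapDomain_symm_mapDomain]

/-- The push-forward preserves total mass. [folklore] -/
theorem mass_mapLaw (μ : FiniteMeasure (QuadConfig D)) : (mapLaw h μ).mass = μ.mass := by
  simp only [FiniteMeasure.mass, mapLaw_apply h μ MeasurableSet.univ, preimage_univ]

/-- **Functoriality of the push-forward: `((g ∘ h)_*)_# = (g_*)_# ∘ (h_*)_#`.** [folklore] -/
theorem mapLaw_trans (g : DomainHomeomorph D' D'') (μ : FiniteMeasure (QuadConfig D)) :
    mapLaw (h.trans g) μ = mapLaw g (mapLaw h μ) := by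
  apply FiniteMeasure.toMeasure_injective
  change (μ : Measure (QuadConfig D)).map (QuadConfig.mapDomain (h.trans g)) =
    ((μ : Measure (QuadConfig D)).map (QuadConfig.mapDomain h)).map (QuadConfig.mapDomain g)
  rw [Measure.map_map (QuadConfig.measurable_mapDomain g) (QuadConfig.measurable_mapDomain h)]
  congr 1
  funext S
  exact QuadConfig.mapDomain_trans h g S

/-- `mapLaw_refl`: structural lemma for the definitions above. [folklore] -/
@[simp] theorem mapLaw_refl (μ : FiniteMeasure (QuadConfig D)) :
    mapLaw (DomainHomeomorph.refl D) μ = μ := by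
  apply FiniteMeasure.toMeasure_injective
  change (μ : Measure (QuadConfig D)).map (QuadConfig.mapDomain (DomainHomeomorph.refl D)) = μ
  rw [show QuadConfig.mapDomain (DomainHomeomorph.refl D) = id from
    funext QuadConfig.mapDomain_refl, Measure.map_id]

/-- `mapLaw_symm_mapLaw`: structural lemma for the definitions above. [folklore] -/
@[simp] theorem mapLaw_symm_mapLaw (μ : FiniteMeasure (QuadConfig D)) :
    mapLaw h.symm (mapLaw h μ) = μ := by
  apply FiniteMeasure.toMeasure_injective
  change ((μ : Measure (QuadConfig D)).map (QuadConfig.mapDomain h)).map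
    (QuadConfig.mapDomain h.symm) = μ
  rw [Measure.map_map (QuadConfig.measurable_mapDomain h.symm) (QuadConfig.measurable_mapDomain h),
    show QuadConfig.mapDomain h.symm ∘ QuadConfig.mapDomain h = id from
      funext (QuadConfig.mapDomain_symm_mapDomain h), Measure.map_id]

/-- `mapLaw_mapLaw_symm`: structural lemma for the definitions above. [folklore] -/
@[simp] theorem mapLaw_mapLaw_symm (μ' : FiniteMeasure (QuadConfig D')) :
    mapLaw h (mapLaw h.symm μ') = μ' := by
  simpa only [DomainHomeomorph.symm_symm] using mapLaw_symm_mapLaw h.symm μ'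

/-- **`(h_*)_#` is continuous for weak convergence of laws** (`h_*` is continuous). [folklore] -/
theorem continuous_mapLaw : Continuous (mapLaw h) :=
  FiniteMeasure.continuous_map (QuadConfig.continuous_mapDomain h)

/-- **The push-forward `(h_*)_# μ` of a Borel probability measure on `ℋ_D`.** [cite: GarbanPeteSchramm2013Pivotal, §2.3] -/
def mapProbLaw (μ : ProbabilityMeasure (QuadConfig D)) : ProbabilityMeasure (QuadConfig D') :=
  μ.map (QuadConfig.measurable_mapDomain h).aemeasurable

/-- `toMeasure_mapProbLaw`: structural lemma for the definitions above. [folklore] -/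
@[simp] theorem toMeasure_mapProbLaw (μ : ProbabilityMeasure (QuadConfig D)) :
    (mapProbLaw h μ : Measure (QuadConfig D')) =
      (μ : Measure (QuadConfig D)).map (QuadConfig.mapDomain h) :=
  rfl

/-- `toFiniteMeasure_mapProbLaw`: structural lemma for the definitions above. [folklore] -/
theorem toFiniteMeasure_mapProbLaw (μ : ProbabilityMeasure (QuadConfig D)) :
    (mapProbLaw h μ).toFiniteMeasure = mapLaw h μ.toFiniteMeasure := rfl

/-- Functoriality of the push-forward of probability measures. [folklore] -/
theorem mapProbLaw_trans (g : DomainHomeomorph D' D'') (μ : ProbabilityMeasure (QuadConfig D)) :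
    mapProbLaw (h.trans g) μ = mapProbLaw g (mapProbLaw h μ) := by
  apply ProbabilityMeasure.toMeasure_injective
  change (μ : Measure (QuadConfig D)).map (QuadConfig.mapDomain (h.trans g)) =
    ((μ : Measure (QuadConfig D)).map (QuadConfig.mapDomain h)).map (QuadConfig.mapDomain g)
  rw [Measure.map_map (QuadConfig.measurable_mapDomain g) (QuadConfig.measurable_mapDomain h)]
  congr 1
  funext S
  exact QuadConfig.mapDomain_trans h g S

/-- `(h_*)_#` is continuous for weak convergence of probability measures. [folklore] -/
theorem continuous_mapProbLaw : Continuous (mapProbLaw h) :=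
  ProbabilityMeasure.continuous_map (QuadConfig.continuous_mapDomain h)

end Laws

/-! ### (c) Encodings of discrete configurations and subsequential scaling limits -/

section Encodings

variable {D D' : Set ℂ}

/-- The quads of `D` **crossed inside a plane set `A`**: those having a crossing contained in `A`
(the tree's `rawCrossedQuads z δ ω D` is the case `A = openEdgeRealization z δ ω`, by `rfl`).
[cite: SchrammSmirnov2011, §1.3] -/
def rawCrossedSet (A : Set ℂ) (D : Set ℂ) : Set (Quad D) := {Q | ∃ K, Q.IsCrossing K ∧ K ⊆ A}

/-- The quads crossed inside `A` form a `≤`-lower set. [cite: SchrammSmirnov2011, §1.3] -/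
theorem rawCrossedSet_lower (A D : Set ℂ) :
    ∀ ⦃Q⦄, Q ∈ rawCrossedSet A D → ∀ ⦃Q'⦄, Quad.Dominated Q' Q → Q' ∈ rawCrossedSet A D := by
  rintro Q ⟨K, hK, hKA⟩ Q' hdom
  obtain ⟨K', hK'K, hK'⟩ := hdom K hK
  exact ⟨K', hK', hK'K.trans hKA⟩

/-- `rawCrossedSet_mono`: structural lemma for the definitions above. [folklore] -/
theorem rawCrossedSet_mono {A B : Set ℂ} (hAB : A ⊆ B) : rawCrossedSet A D ⊆ rawCrossedSet B D :=
  fun _ ⟨K, hK, hKA⟩ => ⟨K, hK, hKA.trans hAB⟩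

/-- Only `A ∩ D` matters (crossings lie in `[Q] ⊆ D`). [folklore] -/
theorem rawCrossedSet_inter (A D : Set ℂ) : rawCrossedSet (A ∩ D) D = rawCrossedSet A D :=
  Subset.antisymm (rawCrossedSet_mono inter_subset_left)
    fun Q ⟨K, hK, hKA⟩ => ⟨K, hK, subset_inter hKA (hK.2.2.1.trans Q.carrier_subset)⟩

/-- `rawCrossedQuads_eq_rawCrossedSet`: structural lemma for the definitions above. [folklore] -/
theorem rawCrossedQuads_eq_rawCrossedSet {V : Type*} (z : V → ℂ) (δ : ℝ) (ω : BondConfig V)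
    (D : Set ℂ) : rawCrossedQuads z δ ω D = rawCrossedSet (openEdgeRealization z δ ω) D := rfl

variable (D) in
/-- **`S_A ∈ ℋ_D`, the configuration of quads of `D` crossed inside the plane set `A`**: the
closure of `rawCrossedSet A D` (a closed lower set, `QuadConfig.ofDominatedLower`).  For `A` the
drawn open edges of a lattice configuration this is Schramm–Smirnov's `S_ω` (the tree's
`configOf z δ D ω`, by `rfl`: `configOf_eq_configOfSet`); for `A = h(open edges ∩ D)` it encodes
the image ("bent") lattice in `ℋ_{h(D)}`. [cite: SchrammSmirnov2011, §1.3] -/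
def configOfSet (A : Set ℂ) : QuadConfig D :=
  QuadConfig.ofDominatedLower (rawCrossedSet A D) (rawCrossedSet_lower A D)

/-- `coe_configOfSet`: structural lemma for the definitions above. [folklore] -/
@[simp] theorem coe_configOfSet (A : Set ℂ) :
    (configOfSet D A : Set (Quad D)) = closure (rawCrossedSet A D) := rfl

/-- `rawCrossedSet_subset_configOfSet`: structural lemma for the definitions above. [folklore] -/
theorem rawCrossedSet_subset_configOfSet (A : Set ℂ) :
    rawCrossedSet A D ⊆ (configOfSet D A : Set (Quad D)) := subset_closure

/-- `configOfSet_mono`: structural lemma for the definitions above. [folklore] -/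
theorem configOfSet_mono {A B : Set ℂ} (hAB : A ⊆ B) : configOfSet D A ≤ configOfSet D B :=
  closure_mono (rawCrossedSet_mono hAB)

/-- `configOfSet_inter`: structural lemma for the definitions above. [folklore] -/
theorem configOfSet_inter (A : Set ℂ) : configOfSet D (A ∩ D) = configOfSet D A :=
  SetLike.ext' (by simp only [coe_configOfSet, rawCrossedSet_inter])

/-- The tree's `configOf z δ D ω` is `configOfSet D (openEdgeRealization z δ ω)`. [folklore] -/
theorem configOf_eq_configOfSet {V : Type*} (z : V → ℂ) (δ : ℝ) (D : Set ℂ) (ω : BondConfig V) :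
    configOf z δ D ω = configOfSet D (openEdgeRealization z δ ω) := rfl

/-- `h` maps the quads of `D` crossed inside `A` onto the quads of `D'` crossed inside
`h(A ∩ D)`. [folklore] -/
theorem image_domainCongr_rawCrossedSet (h : DomainHomeomorph D D') (A : Set ℂ) :
    Quad.domainCongr h '' rawCrossedSet A D = rawCrossedSet (h '' (A ∩ D)) D' := by
  ext Q'
  constructor
  · rintro ⟨Q, ⟨K, hK, hKA⟩, rfl⟩
    exact ⟨h '' K, hK.mapDomain h, image_mono (subset_inter hKA (hK.2.2.1.trans Q.carrier_subset))⟩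
  · rintro ⟨K', hK', hK'A⟩
    refine ⟨Q'.mapDomain h.symm, ⟨h.symm '' K', hK'.mapDomain h.symm, ?_⟩,
      Quad.mapDomain_mapDomain_symm h Q'⟩
    rintro _ ⟨w, hw, rfl⟩
    obtain ⟨z, ⟨hzA, hzD⟩, rfl⟩ := hK'A hw
    rwa [h.symm_apply_apply hzD]

/-- **Transport of encodings: `h_*(S_A) = S_{h(A ∩ D)}`** — the image under `h_*` of the
configuration crossed inside `A` is the configuration of `ℋ_{D'}` crossed inside `h(A ∩ D)`
(`h_*` is a homeomorphism of quad spaces, so it commutes with the closure). [folklore] -/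
theorem QuadConfig.mapDomain_configOfSet (h : DomainHomeomorph D D') (A : Set ℂ) :
    (configOfSet D A).mapDomain h = configOfSet D' (h '' (A ∩ D)) := by
  apply SetLike.ext'
  change Quad.domainCongr h '' closure (rawCrossedSet A D) = closure (rawCrossedSet (h '' (A ∩ D)) D')
  rw [(Quad.domainCongr h).image_closure, image_domainCongr_rawCrossedSet]

/-- **Restriction of encodings: `S_A ∩ 𝒬_U = S_A` computed in `U`** (`U ⊆ D` open): the quads of
`U` crossed inside `A` (the open embedding `𝒬_U → 𝒬_D` pulls closures back to closures).
[cite: SchrammSmirnov2011, Thm. 1.4 (4)] -/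
theorem QuadConfig.restrict_configOfSet {U : Set ℂ} (hU : IsOpen U) (hUD : U ⊆ D) (A : Set ℂ) :
    (configOfSet D A).restrict hU hUD = configOfSet U A := by
  apply SetLike.ext'
  change Quad.incl hUD ⁻¹' closure (rawCrossedSet A D) = closure (rawCrossedSet A U)
  rw [(Quad.isOpenEmbedding_incl hU hUD).isOpenMap.preimage_closure_eq_closure_preimage
    (Quad.continuous_incl hUD)]
  rfl

open Literature.Probability.LatticeModels

variable (D) in
/-- **`S_ω^δ ∈ ℋ_D` for bond percolation on `δℤ²`**: the quads of `D` crossed inside the drawn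
open edges `openEdgeUnion δ ω` (segments `[δx, δy]` of the open edges, vertices at
`meshPoint δ`; the drawing convention of `quadCrossing` in `QuadCrossingRotationInvariance.lean`).
[cite: SchrammSmirnov2011, §1.3] -/
def meshConfig (δ : ℝ) (ω : BondConfig (Site 2)) : QuadConfig D := configOfSet D (openEdgeUnion δ ω)

/-- The configuration seen in a subdomain `U ⊆ D` is the restriction of the one seen in `D`.
[cite: SchrammSmirnov2011, Thm. 1.4 (4)] -/
theorem QuadConfig.restrict_meshConfig {U : Set ℂ} (hU : IsOpen U) (hUD : U ⊆ D) (δ : ℝ)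
    (ω : BondConfig (Site 2)) : (meshConfig D δ ω).restrict hU hUD = meshConfig U δ ω :=
  QuadConfig.restrict_configOfSet hU hUD _

variable (D) in
/-- **`μ_δ`, the law on `ℋ_D` of `S_ω^δ`** under critical bond percolation `P_{1/2}` on `ℤ²`
(`bondPercolation (zdGraph 2) half`), as a finite measure (the push-forward `Measure.map`; cf.
`crossingLaw` in `QuadCrossingSpace.lean` for the measurability remark). [cite: SchrammSmirnov2011, §1.3 and Cor. 1.6] -/
def meshLaw (δ : ℝ) : FiniteMeasure (QuadConfig D) :=
  ⟨(bondPercolation (zdGraph 2) half).map (meshConfig D δ), inferInstance⟩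

/-- `toMeasure_meshLaw`: structural lemma for the definitions above. [folklore] -/
@[simp] theorem toMeasure_meshLaw (δ : ℝ) :
    (meshLaw D δ : Measure (QuadConfig D)) = (bondPercolation (zdGraph 2) half).map (meshConfig D δ) :=
  rfl

/-- **The bent lattice `h(δℤ² ∩ D)` encoded in `ℋ_{D'}`**: the quads of `D'` crossed inside the
image `h(openEdgeUnion δ ω ∩ D)` of the part of the drawn open edges inside `D` (route
`CardyBlackNoise`: "`φ_ε(δℤ² ∩ 𝔻̄)`, image configuration encoded in `ℋ_{φ𝔻}`"; only the part
inside the open domain can be seen by quads of `h(D)`). [folklore] -/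
def imageMeshConfig (h : DomainHomeomorph D D') (δ : ℝ) (ω : BondConfig (Site 2)) : QuadConfig D' :=
  configOfSet D' (h '' (openEdgeUnion δ ω ∩ D))

/-- **The bent configuration is `h_*` of the straight one: `S'_ω = h_*(S_ω)`.** [folklore] -/
theorem imageMeshConfig_eq_mapDomain (h : DomainHomeomorph D D') (δ : ℝ) (ω : BondConfig (Site 2)) :
    imageMeshConfig h δ ω = (meshConfig D δ ω).mapDomain h :=
  (QuadConfig.mapDomain_configOfSet h _).symm

/-- **The law of the bent lattice `h(δℤ² ∩ D)` in `ℋ_{D'}`** under `P_{1/2}`. [folklore] -/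
def imageMeshLaw (h : DomainHomeomorph D D') (δ : ℝ) : FiniteMeasure (QuadConfig D') :=
  ⟨(bondPercolation (zdGraph 2) half).map (imageMeshConfig h δ), inferInstance⟩

/-- `toMeasure_imageMeshLaw`: structural lemma for the definitions above. [folklore] -/
@[simp] theorem toMeasure_imageMeshLaw (h : DomainHomeomorph D D') (δ : ℝ) :
    (imageMeshLaw h δ : Measure (QuadConfig D')) =
      (bondPercolation (zdGraph 2) half).map (imageMeshConfig h δ) :=
  rfl

/-- Push-forward along `h_*` commutes with taking the law of any encoding `f` (also in Mathlib's
junk case: `f` is a.e.-measurable iff `h_* ∘ f` is, `h_*` being a measurable embedding). [folklore] -/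
theorem map_map_mapDomain {α : Type*} [MeasurableSpace α] (P : Measure α) (f : α → QuadConfig D)
    (h : DomainHomeomorph D D') :
    (P.map f).map (QuadConfig.mapDomain h) = P.map (QuadConfig.mapDomain h ∘ f) := by
  by_cases hf : AEMeasurable f P
  · exact AEMeasurable.map_map_of_aemeasurable (QuadConfig.measurable_mapDomain h).aemeasurable hf
  · have hf' : ¬AEMeasurable (QuadConfig.mapDomain h ∘ f) P := fun H =>
      hf ((QuadConfig.measurableEmbedding_mapDomain h).aemeasurable_comp_iff.1 H)
    rw [Measure.map_of_not_aemeasurable hf, Measure.map_of_not_aemeasurable hf', Measure.map_zero]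

/-- **The law of the bent lattice is the push-forward of the law of the straight one:
`μ'_δ = (h_*)_# μ_δ`.** [folklore] -/
theorem imageMeshLaw_eq_mapLaw (h : DomainHomeomorph D D') (δ : ℝ) :
    imageMeshLaw h δ = mapLaw h (meshLaw D δ) := by
  apply FiniteMeasure.toMeasure_injective
  change (bondPercolation (zdGraph 2) half).map (imageMeshConfig h δ) =
    ((bondPercolation (zdGraph 2) half).map (meshConfig D δ)).map (QuadConfig.mapDomain h)
  rw [map_map_mapDomain, show imageMeshConfig h δ = QuadConfig.mapDomain h ∘ meshConfig D δ from
    funext (imageMeshConfig_eq_mapDomain h δ)]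

/-- The crossing probabilities of the bent lattice are those of the straight one:
`μ'_δ(⊞_{h∘Q}) = μ_δ(⊞_Q)`. [folklore] -/
theorem imageMeshLaw_apply_crossedEvent (h : DomainHomeomorph D D') (δ : ℝ) (Q : Quad D) :
    imageMeshLaw h δ (QuadConfig.crossedEvent (Q.mapDomain h)) =
      meshLaw D δ (QuadConfig.crossedEvent Q) := by
  rw [imageMeshLaw_eq_mapLaw, mapLaw_apply_crossedEvent]

variable (D) in
/-- **Subsequential scaling limit (Schramm–Smirnov, Cor. 1.5–1.6, Remark 8).**  `μ` is *the
scaling limit of critical bond percolation on `ℤ²` in `ℋ_D` along the mesh sequence `δ`*: `δ k → 0⁺`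
and the laws `μ_{δ k}` converge weakly to `μ` (Mathlib's topology of weak convergence on
`FiniteMeasure`; "since the target space is metrizable … it is enough to work with convergence
along sequences").  Cor. 1.6: every mesh sequence has a subsequence along which such a `μ`
exists. [cite: SchrammSmirnov2011, Cor. 1.5–1.6 and Remark 8] -/
def IsSubseqScalingLimit (δ : ℕ → ℝ) (μ : FiniteMeasure (QuadConfig D)) : Prop :=
  Tendsto δ atTop (𝓝[>] 0) ∧ Tendsto (fun k => meshLaw D (δ k)) atTop (𝓝 μ)

/-- **Subsequential scaling limit of the bent lattice `h(δℤ² ∩ D)` in `ℋ_{D'}`** along the mesh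
sequence `δ`. [cite: SchrammSmirnov2011, Cor. 1.5–1.6 and Remark 8] -/
def IsSubseqImageScalingLimit (h : DomainHomeomorph D D') (δ : ℕ → ℝ)
    (μ' : FiniteMeasure (QuadConfig D')) : Prop :=
  Tendsto δ atTop (𝓝[>] 0) ∧ Tendsto (fun k => imageMeshLaw h (δ k)) atTop (𝓝 μ')

/-- `IsSubseqScalingLimit.tendsto_mesh`: structural lemma for the definitions above. [folklore] -/
theorem IsSubseqScalingLimit.tendsto_mesh {δ : ℕ → ℝ} {μ : FiniteMeasure (QuadConfig D)}
    (hμ : IsSubseqScalingLimit D δ μ) : Tendsto δ atTop (𝓝[>] 0) := hμ.1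

/-- `IsSubseqScalingLimit.tendsto_law`: structural lemma for the definitions above. [folklore] -/
theorem IsSubseqScalingLimit.tendsto_law {δ : ℕ → ℝ} {μ : FiniteMeasure (QuadConfig D)}
    (hμ : IsSubseqScalingLimit D δ μ) : Tendsto (fun k => meshLaw D (δ k)) atTop (𝓝 μ) := hμ.2

/-- The mesh sequence of a scaling limit is eventually positive and tends to `0`. [folklore] -/
theorem IsSubseqScalingLimit.tendsto_zero {δ : ℕ → ℝ} {μ : FiniteMeasure (QuadConfig D)}
    (hμ : IsSubseqScalingLimit D δ μ) : Tendsto δ atTop (𝓝 0) ∧ ∀ᶠ k in atTop, 0 < δ k :=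
  tendsto_nhdsWithin_iff.1 hμ.1

/-- **`h_*` of a scaling limit along `δ` is the scaling limit of the bent lattice along `δ`**
(`(h_*)_#` is weakly continuous and `μ'_{δ} = (h_*)_# μ_{δ}`). [folklore] -/
theorem IsSubseqScalingLimit.image {δ : ℕ → ℝ} {μ : FiniteMeasure (QuadConfig D)}
    (hμ : IsSubseqScalingLimit D δ μ) (h : DomainHomeomorph D D') :
    IsSubseqImageScalingLimit h δ (mapLaw h μ) := by
  refine ⟨hμ.1, ?_⟩
  simp only [imageMeshLaw_eq_mapLaw]
  exact ((continuous_mapLaw h).tendsto μ).comp hμ.2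

/-- **The bent scaling limits along `δ` are exactly the `h_*`-images of the straight ones**:
`μ'` is the limit of the bent laws along `δ` iff `(h⁻¹_*)_# μ'` is the limit of the straight
laws along `δ`. [folklore] -/
theorem isSubseqImageScalingLimit_iff (h : DomainHomeomorph D D') {δ : ℕ → ℝ}
    {μ' : FiniteMeasure (QuadConfig D')} :
    IsSubseqImageScalingLimit h δ μ' ↔ IsSubseqScalingLimit D δ (mapLaw h.symm μ') := by
  constructor
  · rintro ⟨hδ, hμ'⟩
    refine ⟨hδ, ?_⟩
    have key := ((continuous_mapLaw h.symm).tendsto μ').comp hμ'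
    simp only [Function.comp_def, imageMeshLaw_eq_mapLaw, mapLaw_symm_mapLaw] at key
    exact key
  · intro hμ
    simpa only [mapLaw_mapLaw_symm] using hμ.image h

/-- Scaling limits in the sense of `QuadCrossingSpace.IsSubseqQuadLimit` are phrased with
`∃ δ`; here is the same repackaging for `meshLaw`: a law is a subsequential scaling limit iff it is
one along some mesh sequence. [cite: SchrammSmirnov2011, Cor. 1.6] -/
theorem exists_isSubseqScalingLimit_iff (μ : FiniteMeasure (QuadConfig D)) :
    (∃ δ : ℕ → ℝ, IsSubseqScalingLimit D δ μ) ↔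
      ∃ δ : ℕ → ℝ, (∀ k, 0 < δ k) ∧ Tendsto δ atTop (𝓝 0) ∧
        Tendsto (fun k => meshLaw D (δ k)) atTop (𝓝 μ) := by
  constructor
  · rintro ⟨δ, hδ, hμ⟩
    obtain ⟨hδ0, hpos⟩ := tendsto_nhdsWithin_iff.1 hδ
    obtain ⟨N, hN⟩ := eventually_atTop.1 hpos
    exact ⟨fun k => δ (k + N), fun k => hN _ (Nat.le_add_left N k),
      hδ0.comp (tendsto_add_atTop_nat N), hμ.comp (tendsto_add_atTop_nat N)⟩
  · rintro ⟨δ, hpos, hδ, hμ⟩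
    exact ⟨δ, tendsto_nhdsWithin_iff.2 ⟨hδ, Eventually.of_forall hpos⟩, hμ⟩

end Encodings

end QuadCrossing

end Literature.Probability.Percolation
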